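import Mathlib
import Summits.NavierStokesRegularity.NavierStokesRegularity.Theorems.PoloidalWindowDoorLocalPointZoomSlices
import Summits.NavierStokesRegularity.NavierStokesRegularity.Theorems.PoloidalWindowDoorPoloidalWindowRigidity
import Summits.NavierStokesRegularity.NavierStokesRegularity.Theses.LoopPeriodRatchet

/-! BC3 birth skeleton for crux `PeriodRatchet` of route LoopPeriodRatchet (ns-idea-1 g0).
Two stubs: `stub_comparison` = the NATURAL FORM C⁺ (period comparison for every bounded classical poloidal
Navier–Stokes flow on a compact time interval — the falsifiable statement, tested on heat flows by kit j289854/j290250)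
and `stub_bridge` = the known regularity bridge (Type-I Oseen-mild profiles are bounded classical solutions with bounded
gradient on compact sub-slabs; KNSS 2009 Prop. 4.1 + Fabes–Jones–Rivière). Composition `PeriodRatchet_of` is sorry-free. -/

namespace Summit.NavierStokesRegularity.NavierStokesRegularity.Cruxes.PeriodRatchet.Birth

open scoped RealInnerProductSpace InnerProductSpace

/-- C⁺, the natural form: along every bounded classical e₃-poloidal Navier–Stokes flow (unit viscosity, no force) with bounded
velocity gradient on `[s₁, s₂] × ℝ³`, the sup of inverse periods of closed vortex lines does not increase from `s₁` to `s₂`. -/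
theorem stub_comparison :
    ∀ (s₁ s₂ : ℝ), s₁ < s₂ → ∀ (u : ℝ → EuclideanSpace ℝ (Fin 3) → EuclideanSpace ℝ (Fin 3))
      (p : ℝ → EuclideanSpace ℝ (Fin 3) → ℝ) (B : ℝ),
      Literature.Analysis.FluidPDE.IsClassicalNSSolutionOn (Set.Icc s₁ s₂) 1 0 u p →
      (∀ t ∈ Set.Icc s₁ s₂, ∀ x, ‖u t x‖ ≤ B ∧ ‖fderiv ℝ (u t) x‖ ≤ B) →
      (∀ t ∈ Set.Icc s₁ s₂, ∀ y, ⟪Literature.Analysis.FluidPDE.curl (u t) y, EuclideanSpace.single 2 1⟫_ℝ = 0) →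
      ∀ (γ₂ : ℝ → EuclideanSpace ℝ (Fin 3)) (ℓ₂ : ℝ), 0 < ℓ₂ →
        (∀ θ, HasDerivAt γ₂ (Literature.Analysis.FluidPDE.curl (u s₂) (γ₂ θ)) θ) →
        (∀ θ, γ₂ (θ + ℓ₂) = γ₂ θ) → Literature.Analysis.FluidPDE.curl (u s₂) (γ₂ 0) ≠ 0 →
      ∀ δ : ℝ, 0 < δ →
        ∃ (γ₁ : ℝ → EuclideanSpace ℝ (Fin 3)) (ℓ₁ : ℝ), 0 < ℓ₁ ∧
          (∀ θ, HasDerivAt γ₁ (Literature.Analysis.FluidPDE.curl (u s₁) (γ₁ θ)) θ) ∧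
          (∀ θ, γ₁ (θ + ℓ₁) = γ₁ θ) ∧ Literature.Analysis.FluidPDE.curl (u s₁) (γ₁ 0) ≠ 0 ∧
          ℓ₂⁻¹ ≤ ℓ₁⁻¹ + δ := by
  sorry

/-- Known bridge (KNSS 2009 Prop. 4.1 smoothing + Fabes–Jones–Rivière: mild ⇒ classical): a Type-I Oseen-mild ancient
profile is, on every compact sub-slab `[s₁, s₂] ⊂ (−∞, 0)`, a bounded classical solution with bounded gradient for some
smooth pressure. -/
theorem stub_bridge :
    ∀ (C : ℝ) (v : ℝ → EuclideanSpace ℝ (Fin 3) → EuclideanSpace ℝ (Fin 3)),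
    Literature.Analysis.FluidPDE.HasTypeITimeDecay C v →
    ContinuousOn (Function.uncurry v) (Set.Iio (0 : ℝ) ×ˢ Set.univ) →
    (∀ s t : ℝ, s < t → t < 0 → ∀ x, v t x =
      Literature.Analysis.UnboundedOperators.heatExtension (v s) (t - s) x -
        Literature.Analysis.FluidPDE.oseenDuhamel 1 s v v t x) →
    (∀ t < 0, Literature.Analysis.FluidPDE.VectorCalculus.IsDivFree (v t)) →
    ∀ s₁ s₂ : ℝ, s₁ < s₂ → s₂ < 0 →
      ∃ (p : ℝ → EuclideanSpace ℝ (Fin 3) → ℝ) (B : ℝ),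
        Literature.Analysis.FluidPDE.IsClassicalNSSolutionOn (Set.Icc s₁ s₂) 1 0 v p ∧
        (∀ t ∈ Set.Icc s₁ s₂, ∀ x, ‖v t x‖ ≤ B ∧ ‖fderiv ℝ (v t) x‖ ≤ B) := by
  sorry

/-- Composition lemma (no sorry, unfolded conclusion): C⁺ on the slab `[s₁, s₂]` supplied by the bridge gives the ratchet. -/
theorem periodRatchet_from
    (h₁ : ∀ (s₁ s₂ : ℝ), s₁ < s₂ → ∀ (u : ℝ → EuclideanSpace ℝ (Fin 3) → EuclideanSpace ℝ (Fin 3))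
      (p : ℝ → EuclideanSpace ℝ (Fin 3) → ℝ) (B : ℝ),
      Literature.Analysis.FluidPDE.IsClassicalNSSolutionOn (Set.Icc s₁ s₂) 1 0 u p →
      (∀ t ∈ Set.Icc s₁ s₂, ∀ x, ‖u t x‖ ≤ B ∧ ‖fderiv ℝ (u t) x‖ ≤ B) →
      (∀ t ∈ Set.Icc s₁ s₂, ∀ y, ⟪Literature.Analysis.FluidPDE.curl (u t) y, EuclideanSpace.single 2 1⟫_ℝ = 0) →
      ∀ (γ₂ : ℝ → EuclideanSpace ℝ (Fin 3)) (ℓ₂ : ℝ), 0 < ℓ₂ →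
        (∀ θ, HasDerivAt γ₂ (Literature.Analysis.FluidPDE.curl (u s₂) (γ₂ θ)) θ) →
        (∀ θ, γ₂ (θ + ℓ₂) = γ₂ θ) → Literature.Analysis.FluidPDE.curl (u s₂) (γ₂ 0) ≠ 0 →
      ∀ δ : ℝ, 0 < δ →
        ∃ (γ₁ : ℝ → EuclideanSpace ℝ (Fin 3)) (ℓ₁ : ℝ), 0 < ℓ₁ ∧
          (∀ θ, HasDerivAt γ₁ (Literature.Analysis.FluidPDE.curl (u s₁) (γ₁ θ)) θ) ∧
          (∀ θ, γ₁ (θ + ℓ₁) = γ₁ θ) ∧ Literature.Analysis.FluidPDE.curl (u s₁) (γ₁ 0) ≠ 0 ∧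
          ℓ₂⁻¹ ≤ ℓ₁⁻¹ + δ)
    (h₂ : ∀ (C : ℝ) (v : ℝ → EuclideanSpace ℝ (Fin 3) → EuclideanSpace ℝ (Fin 3)),
    Literature.Analysis.FluidPDE.HasTypeITimeDecay C v →
    ContinuousOn (Function.uncurry v) (Set.Iio (0 : ℝ) ×ˢ Set.univ) →
    (∀ s t : ℝ, s < t → t < 0 → ∀ x, v t x =
      Literature.Analysis.UnboundedOperators.heatExtension (v s) (t - s) x -
        Literature.Analysis.FluidPDE.oseenDuhamel 1 s v v t x) →
    (∀ t < 0, Literature.Analysis.FluidPDE.VectorCalculus.IsDivFree (v t)) →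
    ∀ s₁ s₂ : ℝ, s₁ < s₂ → s₂ < 0 →
      ∃ (p : ℝ → EuclideanSpace ℝ (Fin 3) → ℝ) (B : ℝ),
        Literature.Analysis.FluidPDE.IsClassicalNSSolutionOn (Set.Icc s₁ s₂) 1 0 v p ∧
        (∀ t ∈ Set.Icc s₁ s₂, ∀ x, ‖v t x‖ ≤ B ∧ ‖fderiv ℝ (v t) x‖ ≤ B)) :
  ∀ (C : ℝ) (v : ℝ → EuclideanSpace ℝ (Fin 3) → EuclideanSpace ℝ (Fin 3)),
    Literature.Analysis.FluidPDE.HasTypeITimeDecay C v →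
    ContinuousOn (Function.uncurry v) (Set.Iio (0 : ℝ) ×ˢ Set.univ) →
    (∀ s t : ℝ, s < t → t < 0 → ∀ x, v t x =
      Literature.Analysis.UnboundedOperators.heatExtension (v s) (t - s) x -
        Literature.Analysis.FluidPDE.oseenDuhamel 1 s v v t x) →
    (∀ t < 0, Literature.Analysis.FluidPDE.VectorCalculus.IsDivFree (v t)) →
    (∀ s < 0, ∀ y, ⟪Literature.Analysis.FluidPDE.curl (v s) y, EuclideanSpace.single 2 1⟫_ℝ = 0) →
    ∀ s₁ s₂ : ℝ, s₁ < s₂ → s₂ < 0 →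
    ∀ (γ₂ : ℝ → EuclideanSpace ℝ (Fin 3)) (ℓ₂ : ℝ), 0 < ℓ₂ →
      (∀ θ, HasDerivAt γ₂ (Literature.Analysis.FluidPDE.curl (v s₂) (γ₂ θ)) θ) →
      (∀ θ, γ₂ (θ + ℓ₂) = γ₂ θ) → Literature.Analysis.FluidPDE.curl (v s₂) (γ₂ 0) ≠ 0 →
    ∀ δ : ℝ, 0 < δ →
      ∃ (γ₁ : ℝ → EuclideanSpace ℝ (Fin 3)) (ℓ₁ : ℝ), 0 < ℓ₁ ∧
        (∀ θ, HasDerivAt γ₁ (Literature.Analysis.FluidPDE.curl (v s₁) (γ₁ θ)) θ) ∧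
        (∀ θ, γ₁ (θ + ℓ₁) = γ₁ θ) ∧ Literature.Analysis.FluidPDE.curl (v s₁) (γ₁ 0) ≠ 0 ∧
        ℓ₂⁻¹ ≤ ℓ₁⁻¹ + δ := by
  intro C v hr hc hm hd hpol s₁ s₂ h12 h2 γ₂ ℓ₂ hℓ₂ hγ₂ hper₂ hne₂ δ hδ
  obtain ⟨p, B, hcl, hB⟩ := h₂ C v hr hc hm hd s₁ s₂ h12 h2
  exact h₁ s₁ s₂ h12 v p B hcl hB (fun t ht y => hpol t (lt_of_le_of_lt ht.2 h2) y) γ₂ ℓ₂ hℓ₂ hγ₂ hper₂ hne₂ δ hδ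

/-- THE SKELETON COMPOSITION: the registered stubs, by name, give the crux BY NAME (no sorry outside the stubs). -/
theorem PeriodRatchet_of :
    Summit.NavierStokesRegularity.NavierStokesRegularity.Theses.LoopPeriodRatchet.PeriodRatchet :=
  periodRatchet_from stub_comparison stub_bridge

end Summit.NavierStokesRegularity.NavierStokesRegularity.Cruxes.PeriodRatchet.Birth
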